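import Mathlib
import Summits.ValiantsHypothesis.ValiantsHypothesis.Theorems.RigidityForcesSymmetryRankRigidMinimalReprLaplaceFiveStarWedgePoly

/-!
# ValiantsHypothesis / RigidityForcesSymmetry — crux `LaplaceOptimalFive` (stmt-ValiantsHypothesis-24813), crux idea
`young-shadow` (K1) on the star: **LEMMA K, CASE (a) — OVER A BINARY PENCIL THE CUBIC IS BINARY**
(referee note `NOTE-crit3g5-24813-Lemma2prime-elementary.md` §B (a); memo `NOTE-p4g15-24813-K1-star.md` §14 (a))

`Q₁, Q₂` symmetric quadrics whose matrices `U₁, U₂` have all their columns in the plane `⟨e, f⟩` (a BINARY pencil), `K = Σ C(W a b c) X_a X_b X_c`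
a cubic with `dK ∧ dQ₁ ∧ dQ₂ = 0` (all `3 × 3` minors of `[∂K | ∂Q₁ | ∂Q₂]` vanish, ✓ `wedge_minors_poly`) and one non-zero `2 × 2` minor.
Then (`cubic_annihilated_of_binary`) the symmetric tensor `W` is annihilated by `⟨e, f⟩^⊥`: `Σ_a v_a W(a,b,c) = 0` whenever `v·e = v·f = 0`,
i.e. `K ∈ ℂ[ℓ_e, ℓ_f]₃ = Sym³⟨e, f⟩`.  The paper's coordinate change is replaced by DIRECTIONAL DERIVATIVES `D_v = Σ_a C(v_a) ∂_a`:
`D_v Q_i = 0` for `v ⊥ ⟨e,f⟩`, the contracted minor gives `D_v K · M_{a₀c₀} = 0`, so `D_v K = 0`.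

Also: `dirDeriv_quadric`, `dirDeriv_cubic`, `contracted_minor`, `quadric_tensor_eq_zero`.  Pure algebra; no star hypotheses, no
definitions, no `sorry`.  Honest framing: helper toward the Lean price (L2) of the K1-on-the-star theorem (PAPER, referee PASS; not kernel);
`LaplaceOptimalFive` OPEN · CONTESTED 72/120; `VP ≠ VNP` NOT proved.
-/

set_option linter.dupNamespace false

namespace Summit.ValiantsHypothesis.ValiantsHypothesis.Theorems.RigidityForcesSymmetryRankRigidMinimalRepr

namespace LaplaceFiveStar

open Finset MvPolynomial

/-- Directional derivative of a quadric: `Σ_a C(v_a) ∂_a (Σ C(U a b) X_a X_b) = Σ_b C(Σ_a v_a (U a b + U b a)) X_b`. [folklore] -/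
theorem dirDeriv_quadric (U : Fin 5 → Fin 5 → ℂ) (v : Fin 5 → ℂ) :
    ∑ a : Fin 5, C (v a) * pderiv a (∑ i : Fin 5, ∑ j : Fin 5, C (U i j) * X i * X j : MvPolynomial (Fin 5) ℂ)
      = ∑ b : Fin 5, C (∑ a : Fin 5, v a * (U a b + U b a)) * X b := by
  have e : ∀ a : Fin 5,
      C (v a) * pderiv a (∑ i : Fin 5, ∑ j : Fin 5, C (U i j) * X i * X j : MvPolynomial (Fin 5) ℂ)
        = ∑ b : Fin 5, C (v a * (U a b + U b a)) * X b := fun a => by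
    rw [pderiv_quadric, Finset.mul_sum]
    exact Finset.sum_congr rfl fun b _ => by rw [map_mul]; ring
  rw [Finset.sum_congr rfl fun a _ => e a, Finset.sum_comm]
  exact Finset.sum_congr rfl fun b _ => by rw [map_sum, Finset.sum_mul]

/-- Directional derivative of a cubic:
`Σ_a C(v_a) ∂_a (Σ C(W a b c) X_a X_b X_c) = Σ_{b,c} C(Σ_a v_a (W a b c + W b a c + W b c a)) X_b X_c`. [folklore] -/
theorem dirDeriv_cubic (W : Fin 5 → Fin 5 → Fin 5 → ℂ) (v : Fin 5 → ℂ) :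
    ∑ a : Fin 5, C (v a) *
        pderiv a (∑ i : Fin 5, ∑ j : Fin 5, ∑ l : Fin 5, C (W i j l) * X i * X j * X l : MvPolynomial (Fin 5) ℂ)
      = ∑ b : Fin 5, ∑ c : Fin 5, C (∑ a : Fin 5, v a * (W a b c + W b a c + W b c a)) * X b * X c := by
  have e : ∀ a : Fin 5,
      C (v a) * pderiv a (∑ i : Fin 5, ∑ j : Fin 5, ∑ l : Fin 5, C (W i j l) * X i * X j * X l : MvPolynomial (Fin 5) ℂ)
        = ∑ b : Fin 5, ∑ c : Fin 5, C (v a * (W a b c + W b a c + W b c a)) * X b * X c := fun a => by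
    rw [pderiv_cubic, Finset.mul_sum]
    refine Finset.sum_congr rfl fun b _ => ?_
    rw [Finset.mul_sum]
    exact Finset.sum_congr rfl fun c _ => by rw [map_mul]; ring
  rw [Finset.sum_congr rfl fun a _ => e a, Finset.sum_comm]
  refine Finset.sum_congr rfl fun b _ => ?_
  rw [Finset.sum_comm]
  exact Finset.sum_congr rfl fun c _ => by rw [map_sum, Finset.sum_mul, Finset.sum_mul]

/-- **Contracted minor.**  If all `3 × 3` minors of `[k | p | q]` vanish then, contracting the middle row with a vector `v`:
`M_{ac} · K_v = (k_a q_c − k_c q_a) · P_v + (k_c p_a − k_a p_c) · Q_v` with `K_v = Σ v_b k_b` etc. (any commutative ring). [folklore] -/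
theorem contracted_minor {R : Type*} [CommRing R] {ι : Type*} [Fintype ι] (k p q : ι → R)
    (hT : ∀ u v w : ι, k u * (p v * q w - p w * q v) - k v * (p u * q w - p w * q u) + k w * (p u * q v - p v * q u) = 0)
    (v : ι → R) (a c : ι) :
    (p a * q c - p c * q a) * (∑ b, v b * k b)
      = (k a * q c - k c * q a) * (∑ b, v b * p b) + (k c * p a - k a * p c) * (∑ b, v b * q b) := by
  have e : ∀ b, v b * (k a * (p b * q c - p c * q b) - k b * (p a * q c - p c * q a) + k c * (p a * q b - p b * q a))
      = -((p a * q c - p c * q a) * (v b * k b)) + (k a * q c - k c * q a) * (v b * p b)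
        + (k c * p a - k a * p c) * (v b * q b) := fun b => by ring
  have h : ∑ b, v b * (k a * (p b * q c - p c * q b) - k b * (p a * q c - p c * q a) + k c * (p a * q b - p b * q a)) = 0 :=
    Finset.sum_eq_zero fun b _ => by rw [hT a b c, mul_zero]
  rw [Finset.sum_congr rfl fun b _ => e b, Finset.sum_add_distrib, Finset.sum_add_distrib, Finset.sum_neg_distrib,
    ← Finset.mul_sum, ← Finset.mul_sum, ← Finset.mul_sum] at h
  linear_combination -h

/-- A symmetric matrix whose quadratic form vanishes as a POLYNOMIAL is zero. [folklore] -/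
theorem quadric_tensor_eq_zero (S : Fin 5 → Fin 5 → ℂ) (hS : ∀ a b : Fin 5, S a b = S b a)
    (h : (∑ a : Fin 5, ∑ b : Fin 5, C (S a b) * X a * X b : MvPolynomial (Fin 5) ℂ) = 0) (b c : Fin 5) :
    S b c = 0 := by
  classical
  have h1 := eval_pderiv_quadric S hS (Pi.single c (1 : ℂ)) b
  rw [h, map_zero, map_zero] at h1
  simp [Pi.single_apply] at h1
  exact h1

/-- **LEMMA K, case (a): binary pencil ⟹ binary cubic.**  If all columns of `U₁, U₂` lie in `⟨e, f⟩`, all `3 × 3` minors of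
`[∂K | ∂Q₁ | ∂Q₂]` vanish and `M_{a₀c₀} ≠ 0`, then `Σ_a v_a W(a,b,c) = 0` for every `v` with `v·e = v·f = 0`
(`W` is annihilated by `⟨e,f⟩^⊥`, i.e. `K ∈ Sym³⟨e,f⟩`). [folklore] -/
theorem cubic_annihilated_of_binary (U₁ U₂ : Fin 5 → Fin 5 → ℂ) (W : Fin 5 → Fin 5 → Fin 5 → ℂ)
    (hU1 : ∀ a b : Fin 5, U₁ a b = U₁ b a) (hU2 : ∀ a b : Fin 5, U₂ a b = U₂ b a)
    (hWa : ∀ a b c : Fin 5, W a b c = W b a c) (hWb : ∀ a b c : Fin 5, W a b c = W a c b)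
    (Q₁ Q₂ K : MvPolynomial (Fin 5) ℂ)
    (hQ₁ : Q₁ = ∑ a : Fin 5, ∑ b : Fin 5, C (U₁ a b) * X a * X b)
    (hQ₂ : Q₂ = ∑ a : Fin 5, ∑ b : Fin 5, C (U₂ a b) * X a * X b)
    (hK : K = ∑ a : Fin 5, ∑ b : Fin 5, ∑ c : Fin 5, C (W a b c) * X a * X b * X c)
    (hT : ∀ a b c : Fin 5,
      pderiv a K * (pderiv b Q₁ * pderiv c Q₂ - pderiv c Q₁ * pderiv b Q₂)
        - pderiv b K * (pderiv a Q₁ * pderiv c Q₂ - pderiv c Q₁ * pderiv a Q₂)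
        + pderiv c K * (pderiv a Q₁ * pderiv b Q₂ - pderiv b Q₁ * pderiv a Q₂) = 0)
    (a₀ c₀ : Fin 5) (h0 : pderiv a₀ Q₁ * pderiv c₀ Q₂ - pderiv c₀ Q₁ * pderiv a₀ Q₂ ≠ 0)
    (e f : Fin 5 → ℂ)
    (hcol : ∀ d : Fin 5, (∃ s t : ℂ, ∀ x : Fin 5, U₁ x d = s * e x + t * f x) ∧
      (∃ s t : ℂ, ∀ x : Fin 5, U₂ x d = s * e x + t * f x))
    (v : Fin 5 → ℂ) (hve : ∑ x : Fin 5, v x * e x = 0) (hvf : ∑ x : Fin 5, v x * f x = 0) (b c : Fin 5) :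
    ∑ a : Fin 5, v a * W a b c = 0 := by
  classical
  -- `D_v Q_i = 0`
  have hvU : ∀ (U : Fin 5 → Fin 5 → ℂ), (∀ a b : Fin 5, U a b = U b a) →
      (∀ d : Fin 5, ∃ s t : ℂ, ∀ x : Fin 5, U x d = s * e x + t * f x) →
      ∀ d : Fin 5, ∑ a : Fin 5, v a * (U a d + U d a) = 0 := by
    intro U hU hc d
    obtain ⟨s, t, hst⟩ := hc d
    have e1 : ∀ a : Fin 5, v a * (U a d + U d a) = (2 * s) * (v a * e a) + (2 * t) * (v a * f a) := fun a => by
      rw [hU d a, hst a]; ring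
    rw [Finset.sum_congr rfl fun a _ => e1 a, Finset.sum_add_distrib, ← Finset.mul_sum, ← Finset.mul_sum, hve, hvf]
    ring
  have hP : ∑ a : Fin 5, C (v a) * pderiv a Q₁ = 0 := by
    rw [hQ₁, dirDeriv_quadric]
    exact Finset.sum_eq_zero fun d _ => by rw [hvU U₁ hU1 (fun d => (hcol d).1) d, C_0, zero_mul]
  have hQ : ∑ a : Fin 5, C (v a) * pderiv a Q₂ = 0 := by
    rw [hQ₂, dirDeriv_quadric]
    exact Finset.sum_eq_zero fun d _ => by rw [hvU U₂ hU2 (fun d => (hcol d).2) d, C_0, zero_mul]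
  -- the contracted minor: `M₀ · D_v K = 0`, hence `D_v K = 0`
  have hcm := contracted_minor (fun a => pderiv a K) (fun a => pderiv a Q₁) (fun a => pderiv a Q₂) hT
    (fun a => C (v a)) a₀ c₀
  rw [hP, hQ, mul_zero, mul_zero, add_zero] at hcm
  have hKv : ∑ a : Fin 5, C (v a) * pderiv a K = 0 := (mul_eq_zero.mp hcm).resolve_left h0
  -- `D_v K` is the quadric of the symmetric matrix `3 Σ_a v_a W(a,·,·)`
  rw [hK, dirDeriv_cubic] at hKv
  have hsym : ∀ a b c : Fin 5, W a b c + W b a c + W b c a = 3 * W a b c := by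
    intro a b c
    have h1 : W b a c = W a b c := (hWa a b c).symm
    have h2 : W b c a = W a b c := by rw [hWb b c a, ← hWa a b c]
    rw [h1, h2]
    ring
  simp only [hsym] at hKv
  have hS : ∀ x y : Fin 5, (∑ a : Fin 5, v a * (3 * W a x y)) = ∑ a : Fin 5, v a * (3 * W a y x) := fun x y =>
    Finset.sum_congr rfl fun a _ => by rw [hWb a x y]
  have h3 := quadric_tensor_eq_zero (fun x y => ∑ a : Fin 5, v a * (3 * W a x y)) hS hKv b c
  have e3 : (∑ a : Fin 5, v a * (3 * W a b c)) = 3 * ∑ a : Fin 5, v a * W a b c := by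
    rw [Finset.mul_sum]; exact Finset.sum_congr rfl fun a _ => by ring
  rw [e3] at h3
  exact (mul_eq_zero.mp h3).resolve_left three_ne_zero

end LaplaceFiveStar

end Summit.ValiantsHypothesis.ValiantsHypothesis.Theorems.RigidityForcesSymmetryRankRigidMinimalRepr
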